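import Summits.Ventures.Crystal3D.Theorems.StickyWulffConstantNoReconstructionGainLowCoordRim
import HarnessLib

/-!
# The width-three rim of the `(111)` slab sample has `O(ρ)` sites

HONEST FRAMING. Part of the venture `Summits/Ventures/Crystal3D` (cell `crystal3d-full`), helper
`--supports` the crux `NoReconstructionGain` (stmt-Ventures-19144, route
`route-Ventures-StickyWulffConstant`), line `adhesion`, GRAIN RUNG.  Counting only, the
width-`3` variant of `card_rim_le` (`…LowCoordRim`, width `2`): with `P` the slab sample at
`ν = e₃`, `R = 4` (all sites of `fccStacking 1 √(2/3)` with `−8 ≤ z ≤ −4` and lateral radius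
`≤ ρ`; five hexagonal layers `k = −9, …, −5`), the sites of lateral radius `> ρ − 3` number at
most `85 π ρ` for `ρ ≥ 4` (`card_rim_three_le`): per layer, the upper disc count
`(√3/2)·# ≤ π(ρ+2)²` (`triangular_disc_count_upper`) minus, when `ρ ≥ 5`, the lower count
`(2/√3)π(ρ−5)² ≤ #` of the inner disc of radius `ρ − 3` (`triangular_disc_count`) is
`≤ (2/√3)π(14ρ − 21) ≤ 17πρ`; for `4 ≤ ρ < 5` the whole layer already has `≤ 17πρ` sites.
The grain rung needs width `3` so that every lattice slot of a ball touching a CORE site stays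
inside the forbidden region of `…GrainGeom`.

WHAT THIS IS NOT: nothing about packings beyond counting; rung F-C1 not moved.
-/

noncomputable section

namespace Summit.Ventures.Crystal3D.Theorems

open Summit.Ventures.Crystal3D Finset Real
open Literature.MathematicalPhysics.StatisticalMechanics (barlowPos barlowStacking fccStacking
  constHagg isHaggSeq_const haggLabel_const barlowPos_mem barlowPos_apply_zero barlowPos_apply_one
  barlowPos_apply_two le_dist_barlowPos_of_ideal)
open scoped InnerProductSpace

/-- **Width-three rim count.**  With `P` the slab sample as above (`ρ ≥ 4`), the sites of `P`
with lateral radius `> ρ − 3` number at most `85 π ρ`. -/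
theorem card_rim_three_le (ρ : ℝ) (hρ : 4 ≤ ρ) (P : Finset (EuclideanSpace ℝ (Fin 3)))
    (hP : ∀ p, p ∈ P ↔ (p ∈ fccStacking 1 (Real.sqrt (2 / 3)) ∧ -8 ≤ p 2 ∧ p 2 ≤ -4 ∧
      p 0 ^ 2 + p 1 ^ 2 ≤ ρ ^ 2)) :
    ((P.filter fun p => (ρ - 3) ^ 2 < p 0 ^ 2 + p 1 ^ 2).card : ℝ) ≤ 85 * Real.pi * ρ := by
  classical
  obtain ⟨hh2, hh45, hh89⟩ := sqrt_two_thirds_bounds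
  set h : ℝ := Real.sqrt (2 / 3) with hhdef
  have hhpos : 0 < h := by linarith
  have hh : h ^ 2 = 2 / 3 * (1 : ℝ) ^ 2 := by rw [hh2]; ring
  have h3 : (0 : ℝ) < Real.sqrt 3 := Real.sqrt_pos.2 (by norm_num)
  have h3sq : Real.sqrt 3 ^ 2 = 3 := Real.sq_sqrt (by norm_num)
  have h3lo : (17 : ℝ) / 10 ≤ Real.sqrt 3 :=
    (pow_le_pow_iff_left₀ (by norm_num) h3.le two_ne_zero).1 (by rw [h3sq]; norm_num)
  have h23 : 2 / Real.sqrt 3 ≤ 20 / 17 := by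
    rw [div_le_div_iff₀ h3 (by norm_num)]; linarith
  have hfcc_inj : ∀ {k₁ a₁ b₁ k₂ a₂ b₂ : ℤ},
      barlowPos 1 h constHagg k₁ a₁ b₁ = barlowPos 1 h constHagg k₂ a₂ b₂ →
        (k₁, a₁, b₁) = (k₂, a₂, b₂) := by
    intro k₁ a₁ b₁ k₂ a₂ b₂ heq
    by_contra hne
    have h1 := le_dist_barlowPos_of_ideal isHaggSeq_const one_pos hh hne
    rw [heq, dist_self] at h1
    exact absurd h1 (by norm_num)
  -- every sample site has integer coordinates with layer index in `[-9, -5]`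
  have hcoord : ∀ p ∈ P, ∃ k i j : ℤ, -9 ≤ k ∧ k ≤ -5 ∧ p = barlowPos 1 h constHagg k i j := by
    intro p hp
    obtain ⟨hΛ, hz1, hz2, -⟩ := (hP p).1 hp
    obtain ⟨k, i, j, rfl⟩ := hΛ
    rw [barlowPos_apply_two] at hz1 hz2
    refine ⟨k, i, j, ?_, ?_, rfl⟩
    · by_contra hk
      have : (k : ℝ) ≤ -10 := by exact_mod_cast (show k ≤ -10 by omega)
      nlinarith
    · by_contra hk
      have : (-4 : ℝ) ≤ k := by exact_mod_cast (show -4 ≤ k by omega)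
      nlinarith
  -- layer by layer
  set K : Finset ℤ := Finset.Icc (-9) (-5) with hK
  have hKcard : K.card = 5 := by rw [hK]; rfl
  set rim := P.filter fun p => (ρ - 3) ^ 2 < p 0 ^ 2 + p 1 ^ 2 with hrim
  set layer : ℤ → Finset (EuclideanSpace ℝ (Fin 3)) := fun k =>
    P.filter fun p => p 2 = (k : ℝ) * h with hlayer
  have hrim_sub : rim ⊆ K.biUnion fun k => (layer k).filter
      fun p => (ρ - 3) ^ 2 < p 0 ^ 2 + p 1 ^ 2 := by
    intro p hp
    rw [hrim, mem_filter] at hp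
    obtain ⟨k, i, j, hk1, hk2, hpk⟩ := hcoord p hp.1
    rw [mem_biUnion]
    refine ⟨k, by rw [hK, Finset.mem_Icc]; exact ⟨hk1, hk2⟩, ?_⟩
    rw [mem_filter, hlayer, mem_filter]
    exact ⟨⟨hp.1, by rw [hpk, barlowPos_apply_two]⟩, hp.2⟩
  -- per-layer bound
  have hper : ∀ k ∈ K, (((layer k).filter fun p => (ρ - 3) ^ 2 < p 0 ^ 2 + p 1 ^ 2).card : ℝ)
      ≤ 17 * Real.pi * ρ := by
    intro k hk
    rw [hK, Finset.mem_Icc] at hk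
    -- index map on the layer
    have hidx : ∀ p ∈ layer k, ∃ ij : ℤ × ℤ, p = barlowPos 1 h constHagg k ij.1 ij.2 := by
      intro p hp
      rw [hlayer, mem_filter] at hp
      obtain ⟨k', i, j, -, -, hpk⟩ := hcoord p hp.1
      have : k' = k := by
        have hz := hp.2
        rw [hpk, barlowPos_apply_two] at hz
        have := mul_right_cancel₀ hhpos.ne' hz
        exact_mod_cast this
      exact ⟨(i, j), by rw [hpk, this]⟩
    set g : EuclideanSpace ℝ (Fin 3) → ℤ × ℤ := fun p =>
      if hq : ∃ ij : ℤ × ℤ, p = barlowPos 1 h constHagg k ij.1 ij.2 then hq.choose else (0, 0)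
      with hg
    have hg_spec : ∀ p ∈ layer k, p = barlowPos 1 h constHagg k (g p).1 (g p).2 := by
      intro p hp
      have hex := hidx p hp
      rw [hg]; simp only [hex, dif_pos]
      exact hex.choose_spec
    have hg_inj : Set.InjOn g ↑(layer k) := by
      intro p hp p' hp' hpp
      rw [hg_spec p (mem_coe.1 hp), hg_spec p' (mem_coe.1 hp'), hpp]
    -- lateral radius of a layer-`k` site in coordinates
    have hlat : ∀ i j : ℤ, barlowPos 1 h constHagg k i j 0 ^ 2 +
        barlowPos 1 h constHagg k i j 1 ^ 2 =
        ((i : ℝ) + (j : ℝ) / 2 - (-(k : ℝ) / 2)) ^ 2 +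
          (Real.sqrt 3 / 2 * (j : ℝ) - (-(Real.sqrt 3 / 6 * k))) ^ 2 := by
      intro i j
      rw [barlowPos_apply_zero, barlowPos_apply_one, haggLabel_const]; push_cast; ring
    -- upper count for the whole layer
    set Tup : Finset (ℤ × ℤ) := (layer k).image g with hTup
    have hup := triangular_disc_count_upper (-(k : ℝ) / 2) (-(Real.sqrt 3 / 6 * k)) ρ (by linarith)
      Tup (by
        intro ij hij
        rw [hTup, mem_image] at hij
        obtain ⟨p, hp, rfl⟩ := hij
        have hpP : p ∈ P := (mem_filter.1 (show p ∈ layer k from hp)).1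
        have hl := ((hP p).1 hpP).2.2.2
        rw [hg_spec p hp, hlat] at hl
        exact hl)
    have hTup_card : Tup.card = (layer k).card := by rw [hTup, card_image_of_injOn hg_inj]
    have hup' : ((layer k).card : ℝ) ≤ 2 / Real.sqrt 3 * (Real.pi * (ρ + 2) ^ 2) := by
      rw [← hTup_card, div_mul_eq_mul_div, le_div_iff₀ h3]; linarith
    have hsub_layer : ((layer k).filter fun p => (ρ - 3) ^ 2 < p 0 ^ 2 + p 1 ^ 2) ⊆ layer k :=
      filter_subset _ _
    by_cases hρ5 : ρ < 5
    · -- small radius: the whole layer has `≤ 17 π ρ` sites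
      have hsq : (ρ + 2) ^ 2 ≤ 21 / 2 * ρ := by nlinarith
      calc (((layer k).filter fun p => (ρ - 3) ^ 2 < p 0 ^ 2 + p 1 ^ 2).card : ℝ)
          ≤ ((layer k).card : ℝ) := by exact_mod_cast card_le_card hsub_layer
        _ ≤ 2 / Real.sqrt 3 * (Real.pi * (ρ + 2) ^ 2) := hup'
        _ ≤ 20 / 17 * (Real.pi * (21 / 2 * ρ)) := by
            have hpos : 0 ≤ Real.pi * (ρ + 2) ^ 2 := by positivity
            calc 2 / Real.sqrt 3 * (Real.pi * (ρ + 2) ^ 2)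
                ≤ 20 / 17 * (Real.pi * (ρ + 2) ^ 2) := mul_le_mul_of_nonneg_right h23 hpos
              _ ≤ 20 / 17 * (Real.pi * (21 / 2 * ρ)) := by
                  have := mul_le_mul_of_nonneg_left hsq Real.pi_pos.le
                  nlinarith
        _ ≤ 17 * Real.pi * ρ := by nlinarith [Real.pi_pos]
    · -- `ρ ≥ 5`: subtract the inner disc of radius `ρ - 3 ≥ 2`
      have hρ5' : 5 ≤ ρ := not_lt.1 hρ5
      set inner := (layer k).filter fun p => p 0 ^ 2 + p 1 ^ 2 ≤ (ρ - 3) ^ 2 with hinner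
      set Tlo : Finset (ℤ × ℤ) := inner.image g with hTlo
      have hlo := triangular_disc_count (-(k : ℝ) / 2) (-(Real.sqrt 3 / 6 * k)) (ρ - 3)
        (by linarith) Tlo (by
          intro i j hcond
          set p := barlowPos 1 h constHagg k i j with hpdef
          have hl : p 0 ^ 2 + p 1 ^ 2 ≤ (ρ - 3) ^ 2 := by rw [hpdef, hlat]; exact hcond
          have hpP : p ∈ P := by
            rw [hP]
            refine ⟨barlowPos_mem _ _ _, ?_, ?_, by nlinarith⟩
            · rw [hpdef, barlowPos_apply_two]
              have : (-9 : ℝ) ≤ k := by exact_mod_cast hk.1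
              nlinarith
            · rw [hpdef, barlowPos_apply_two]
              have : (k : ℝ) ≤ -5 := by exact_mod_cast hk.2
              nlinarith
          have hpl : p ∈ layer k := by
            rw [hlayer, mem_filter]; exact ⟨hpP, by rw [hpdef, barlowPos_apply_two]⟩
          have hpi : p ∈ inner := by rw [hinner, mem_filter]; exact ⟨hpl, hl⟩
          have hgp : g p = (i, j) := by
            have := hfcc_inj ((hg_spec p hpl).symm.trans hpdef)
            simp only [Prod.mk.injEq] at this
            exact Prod.ext this.2.1 this.2.2
          rw [hTlo, mem_image]; exact ⟨p, hpi, hgp⟩)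
      have hTlo_card : Tlo.card = inner.card := by
        rw [hTlo, card_image_of_injOn fun p hp p' hp' hpp =>
          hg_inj (mem_coe.2 (mem_filter.1 (mem_coe.1 hp)).1)
            (mem_coe.2 (mem_filter.1 (mem_coe.1 hp')).1) hpp]
      -- rim of the layer = layer minus inner disc
      have hsplit : ((layer k).filter fun p => (ρ - 3) ^ 2 < p 0 ^ 2 + p 1 ^ 2).card +
          inner.card = (layer k).card := by
        rw [hinner]
        have := card_filter_add_card_filter_not (s := layer k)
          (fun p => (ρ - 3) ^ 2 < p 0 ^ 2 + p 1 ^ 2)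
        rw [← this]
        congr 2
        exact filter_congr fun p _ => by simp [not_lt]
      have e1 : (((layer k).filter fun p => (ρ - 3) ^ 2 < p 0 ^ 2 + p 1 ^ 2).card : ℝ) =
          ((layer k).card : ℝ) - (Tlo.card : ℝ) := by
        rw [hTlo_card]
        have : (((layer k).filter fun p => (ρ - 3) ^ 2 < p 0 ^ 2 + p 1 ^ 2).card : ℝ) +
            (inner.card : ℝ) = ((layer k).card : ℝ) := by exact_mod_cast hsplit
        linarith
      rw [e1]
      have hlo' : 2 / Real.sqrt 3 * Real.pi * (ρ - 3 - 2) ^ 2 ≤ (Tlo.card : ℝ) := hlo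
      have hdiff : 2 / Real.sqrt 3 * (Real.pi * (ρ + 2) ^ 2) -
          2 / Real.sqrt 3 * Real.pi * (ρ - 3 - 2) ^ 2
          = 2 / Real.sqrt 3 * (Real.pi * (14 * ρ - 21)) := by ring
      have hpos : 0 ≤ Real.pi * (14 * ρ - 21) := by nlinarith [Real.pi_pos]
      calc ((layer k).card : ℝ) - Tlo.card
          ≤ 2 / Real.sqrt 3 * (Real.pi * (ρ + 2) ^ 2) -
              2 / Real.sqrt 3 * Real.pi * (ρ - 3 - 2) ^ 2 := by linarith
        _ = 2 / Real.sqrt 3 * (Real.pi * (14 * ρ - 21)) := hdiff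
        _ ≤ 20 / 17 * (Real.pi * (14 * ρ - 21)) := mul_le_mul_of_nonneg_right h23 hpos
        _ ≤ 17 * Real.pi * ρ := by nlinarith [Real.pi_pos]
  -- sum over the five layers
  calc (rim.card : ℝ)
      ≤ ((K.biUnion fun k => (layer k).filter
          fun p => (ρ - 3) ^ 2 < p 0 ^ 2 + p 1 ^ 2).card : ℝ) := by
        exact_mod_cast card_le_card hrim_sub
    _ ≤ ∑ k ∈ K, (((layer k).filter fun p => (ρ - 3) ^ 2 < p 0 ^ 2 + p 1 ^ 2).card : ℝ) := by
        exact_mod_cast card_biUnion_le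
    _ ≤ ∑ _k ∈ K, 17 * Real.pi * ρ := sum_le_sum hper
    _ = 85 * Real.pi * ρ := by rw [sum_const, hKcard]; ring

end Summit.Ventures.Crystal3D.Theorems

end
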